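import Mathlib.AlgebraicGeometry.ValuativeCriterion
import Literature.AlgebraicGeometry.Motives.GoodReduction
import Literature.AlgebraicGeometry.Motives.BaseChange
import HarnessLib

/-!
# Sections of a proper model over a valuation ring: extending a rational point of the generic fibre

Topic `Literature/AlgebraicGeometry/Motives`, namespace `Literature.AlgebraicGeometry.Motives.IntegralModel`.  THEOREMS ONLY;
no definition, no named fact (net Literature debt **0**).  Written for the cell `hodgecm-mathlib` (D-0151), E2 line (A-p02's
P1-SPEC, piece **(P1-char) F-A**): the zero section of the good-reduction model of an abelian variety over `𝓞_{k,𝔓}` WITHOUT a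
group law on the model — the model is a bare `IntegralModel` (`Motives/GoodReduction`), and the section is produced by the
valuative criterion.

THE PRINT.  [Hartshorne1977] II Thm. 4.7 / [StacksProject, Tag 0BX5] (valuative criterion of properness; Mathlib
`IsProper.eq_valuativeCriterion`): for `𝒳 → Spec R` proper, `R` a valuation ring with fraction field `K`, every `K`-point of
the generic fibre extends UNIQUELY to a section `Spec R → 𝒳` ([BoschLutkebohmertRaynaud1990] §1.1: «`𝒳(R) = 𝒳_K(K)` for `𝒳`
proper», the property that makes the zero section and the Néron mapping property for sections automatic).  [GortzWedhorn2020]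
Example 2.33 / Prop. 3.33: `Spec` of a local ring has a unique closed point, contained in every non-empty closed subset, so an
open containing the image of the closed point under a section pulls back to everything.

* `IntegralModel.exists_section_of_point` — a `K`-rational point `x` of `X` gives a section `e : Spec R → 𝒳` of the proper model
  `𝒳` whose generic point is `x` (read in `𝒳` through `genericIso⁻¹` and the projection `𝒳_K → 𝒳`).
* `IntegralModel.section_ext` — two sections of a SEPARATED model with the same generic point are equal (valuative uniqueness).
* `IntegralModel.section_comp_left_eq_of_generic` — an endomorphism of the model fixing the generic point of a section fixes the
  section.
* `preimage_eq_top_of_closedPoint_mem`, `exists_isAffineOpen_preimage_section_eq_top` — an (affine) open through the closed point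
  of a section contains the whole section.

## References
* [Hartshorne1977] R. Hartshorne, *Algebraic Geometry*, II Thm. 4.7 (valuative criterion of properness), II Ex. 4.11.
* [StacksProject] Tag 0BX5 (valuative criterion for properness), Tag 01KF (universally closed).
* [BoschLutkebohmertRaynaud1990] S. Bosch, W. Lütkebohmert, M. Raynaud, *Néron Models*, §1.1 (sections of proper models).
* [GortzWedhorn2020] U. Görtz, T. Wedhorn, *Algebraic Geometry I* (2nd ed.), Example 2.33, Section (4.7).
* [SerreTate1968] J.-P. Serre, J. Tate, *Good reduction of abelian varieties*, §1 (models over `𝓞_{K,v}`).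
-/

noncomputable section

-- Compositions through `((baseChange R K).obj X).left = pullback X.hom _` are definitional only above `instances`
-- transparency (as in Mathlib's `Over.pullback` API and the tree's `Motives/BaseChange`).
set_option backward.isDefEq.respectTransparency false

universe u

open CategoryTheory CategoryTheory.Limits AlgebraicGeometry

namespace Literature.AlgebraicGeometry.Motives

/-! ### Opens through the closed point of `Spec` of a local ring -/

/-- For a morphism `e : Spec R → Y` from the spectrum of a LOCAL ring, an open of `Y` containing the image of the closed point
contains the image of every point (every point of `Spec R` specialises to the closed point): `e⁻¹ U = ⊤`.
[cite: GortzWedhorn2020, Example 2.33 (Spec of a local ring)] -/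
theorem preimage_eq_top_of_closedPoint_mem {R : Type u} [CommRing R] [IsLocalRing R] {Y : Scheme.{u}}
    (e : Spec (.of R) ⟶ Y) (U : Y.Opens) (h : e (IsLocalRing.closedPoint R) ∈ U) : e ⁻¹ᵁ U = ⊤ :=
  (IsLocalRing.closedPoint_mem_iff (e ⁻¹ᵁ U)).mp h

/-- Through the closed point of a morphism `e : Spec R → Y` (`R` local) there is an AFFINE open of `Y`, and it contains the image
of all of `Spec R`. [cite: GortzWedhorn2020, Example 2.33 and Prop. 3.2 (affine opens form a basis)] -/
theorem exists_isAffineOpen_preimage_eq_top {R : Type u} [CommRing R] [IsLocalRing R] {Y : Scheme.{u}}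
    (e : Spec (.of R) ⟶ Y) : ∃ W : Y.Opens, IsAffineOpen W ∧ e ⁻¹ᵁ W = ⊤ := by
  let y := e (IsLocalRing.closedPoint R)
  refine ⟨(Y.affineCover.f (Y.affineCover.idx y)).opensRange, isAffineOpen_opensRange _,
    preimage_eq_top_of_closedPoint_mem e _ ?_⟩
  exact Y.affineCover.covers y

namespace IntegralModel

variable {R K : Type u} [CommRing R] [Field K] [Algebra R K] {X : SchemeOver K} (𝒳 : IntegralModel R K X)

/-- The projection `𝒳_K → 𝒳` followed by the structure map of the model is the structure map of the generic fibre followed by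
`Spec K → Spec R` (the cartesian square of the generic fibre). [cite: GortzWedhorn2020, Section (4.7)] -/
theorem baseChangeHomFst_comp_hom :
    baseChangeHomFst (algebraMap R K) 𝒳.total ≫ 𝒳.total.hom =
      ((baseChange R K).obj 𝒳.total).hom ≫ Spec.map (CommRingCat.ofHom (algebraMap R K)) :=
  pullback.condition

/-- The generic point `x ↦ 𝒳` of a `K`-rational point `x` of `X`, read in the model through `genericIso⁻¹` and the projection,
lies over `Spec K → Spec R`. [cite: GortzWedhorn2020, Section (4.7)] -/
theorem point_generic_comp_hom (x : Spec (.of K) ⟶ X.left) (hx : x ≫ X.hom = 𝟙 _) :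
    (x ≫ 𝒳.genericIso.inv.left ≫ baseChangeHomFst (algebraMap R K) 𝒳.total) ≫ 𝒳.total.hom =
      Spec.map (CommRingCat.ofHom (algebraMap R K)) := by
  rw [Category.assoc, Category.assoc, baseChangeHomFst_comp_hom, ← Category.assoc 𝒳.genericIso.inv.left, Over.w,
    ← Category.assoc, hx, Category.id_comp]

/-- **Rational points of the generic fibre extend to sections of a proper model over a valuation ring** (valuative criterion of
properness, existence): for `x ∈ X(K)` there is `e : Spec R → 𝒳` with `e ≫ (𝒳 → Spec R) = 𝟙` and generic point `x`.
[cite: Hartshorne1977, II Thm. 4.7] [cite: StacksProject, Tag 0BX5] [cite: BoschLutkebohmertRaynaud1990, §1.1] -/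
theorem exists_section_of_point [IsDomain R] [ValuationRing R] [IsFractionRing R K] [IsProper 𝒳.total.hom]
    (x : Spec (.of K) ⟶ X.left) (hx : x ≫ X.hom = 𝟙 _) :
    ∃ e : Spec (.of R) ⟶ 𝒳.total.left, e ≫ 𝒳.total.hom = 𝟙 _ ∧
      Spec.map (CommRingCat.ofHom (algebraMap R K)) ≫ e = x ≫ 𝒳.genericIso.inv.left ≫ baseChangeHomFst (algebraMap R K) 𝒳.total := by
  -- the valuative square `Spec K → 𝒳`, `Spec R → Spec R`
  let S : ValuativeCommSq 𝒳.total.hom :=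
    { R := R, K := K
      i₁ := x ≫ 𝒳.genericIso.inv.left ≫ baseChangeHomFst (algebraMap R K) 𝒳.total
      i₂ := 𝟙 _
      commSq := ⟨by rw [Category.comp_id, point_generic_comp_hom 𝒳 x hx]⟩ }
  have hV : (ValuativeCriterion ⊓ @QuasiCompact ⊓ @QuasiSeparated ⊓ @LocallyOfFiniteType) 𝒳.total.hom := by
    rw [← IsProper.eq_valuativeCriterion]; infer_instance
  obtain ⟨⟨l⟩⟩ := hV.1.1.1 S
  exact ⟨l.default.l, l.default.fac_right, l.default.fac_left⟩

/-- **Uniqueness of sections with given generic point** (valuative criterion, uniqueness; the model need only be separated).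
[cite: Hartshorne1977, II Thm. 4.7 and Ex. 4.11] [cite: StacksProject, Tag 0BX5] -/
theorem section_ext [IsDomain R] [ValuationRing R] [IsFractionRing R K] [IsSeparated 𝒳.total.hom]
    (e e' : Spec (.of R) ⟶ 𝒳.total.left) (he : e ≫ 𝒳.total.hom = 𝟙 _)
    (he' : e' ≫ 𝒳.total.hom = 𝟙 _)
    (h : Spec.map (CommRingCat.ofHom (algebraMap R K)) ≫ e = Spec.map (CommRingCat.ofHom (algebraMap R K)) ≫ e') : e = e' := by
  let S : ValuativeCommSq 𝒳.total.hom :=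
    { R := R, K := K
      i₁ := Spec.map (CommRingCat.ofHom (algebraMap R K)) ≫ e
      i₂ := 𝟙 _
      commSq := ⟨by rw [Category.comp_id, Category.assoc, he, Category.comp_id]⟩ }
  have hU : Subsingleton S.commSq.LiftStruct := IsSeparated.valuativeCriterion (f := 𝒳.total.hom) S
  have h₁ : (⟨e, rfl, he⟩ : S.commSq.LiftStruct) = ⟨e', h.symm, he'⟩ := Subsingleton.elim _ _
  exact congrArg CommSq.LiftStruct.l h₁

/-- **An endomorphism of the model fixing the generic point of a section fixes the section**: for `v : 𝒳 → 𝒳` over `Spec R` and a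
section `e` with `(Spec K → Spec R → 𝒳) ≫ v = (Spec K → Spec R → 𝒳)`, `e ≫ v = e` (both are sections with the same generic
point). [cite: Hartshorne1977, II Thm. 4.7 and Ex. 4.11] [cite: BoschLutkebohmertRaynaud1990, §1.1] -/
theorem section_comp_left_eq_of_generic [IsDomain R] [ValuationRing R] [IsFractionRing R K] [IsSeparated 𝒳.total.hom]
    (e : Spec (.of R) ⟶ 𝒳.total.left)
    (he : e ≫ 𝒳.total.hom = 𝟙 _) (v : 𝒳.total ⟶ 𝒳.total)
    (hv : (Spec.map (CommRingCat.ofHom (algebraMap R K)) ≫ e) ≫ v.left = Spec.map (CommRingCat.ofHom (algebraMap R K)) ≫ e) :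
    e ≫ v.left = e :=
  𝒳.section_ext (e ≫ v.left) e (by rw [Category.assoc, Over.w v, he]) he (by rw [← Category.assoc, hv])

/-- A section `e` of the model over a LOCAL valuation ring has an affine chart: an affine open `W ⊆ 𝒳` with `e⁻¹ W = ⊤`.
[cite: GortzWedhorn2020, Example 2.33 and Prop. 3.2] -/
theorem exists_isAffineOpen_preimage_section_eq_top [IsLocalRing R] (e : Spec (.of R) ⟶ 𝒳.total.left) :
    ∃ W : 𝒳.total.left.Opens, IsAffineOpen W ∧ e ⁻¹ᵁ W = ⊤ :=
  exists_isAffineOpen_preimage_eq_top e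

end IntegralModel

end Literature.AlgebraicGeometry.Motives

end
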